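import Summits.Ventures.CertifiedManyBodySolver.Downfold.EmeryBoxesHg1223OPThermalCapRetiltBoxp1
import Summits.Ventures.CertifiedManyBodySolver.Downfold.EmeryBoxesHg1223OPThermalCapWord
import Summits.Ventures.CertifiedManyBodySolver.Downfold.EmeryThermalAtomicFloor
import HarnessLib

/-!
# HIGH-TEMPERATURE-CLOSING `T > 0` WINDOW on HgBa2Ca2Cu3O8 #35/M35 @0 OUTER planes (site-mean filling) — `emeryBoxHg1223OP` (router/EMERY-FLOOR-ORDERS row 18): the ATOMIC-LIMIT floor (full entropy) ∨ the
# family floor, against the re-tilted cap — both sides meet at `6 log 2` as β → 0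

Venture CertifiedManyBodySolver, cell `pub/hubbard-downfold` (S1 = ROUTER) × crew hubbard-fast S2 (ii) × (iv) «T > 0 × multi-band» (D-0096 (ii)); seat hubbard-downfold-mod-4
(S1/S2 Emery seam, g17). Namespace `Summit.Ventures.CertifiedManyBodySolver.Downfold`. DOOR: `EmeryThermalAtomicFloor` (`holdsOn_emeryCellPressureAtomicFloor`: Peierls on the
whole occupation basis of the `Cu₄O₈` block, site-wise factorisation; the one-site function is the tree's `atomicPartitionFnReal β U μ`). INPUTS BY NAME: the family floor
`emeryBoxHg1223OP_pressureFloorFam_m101o10` (`EmeryBoxesHg1223OPThermalCapWord`; C = (-151.749501, -153.455441)), the cap `emeryBoxHg1223OP_pressureCap_m101o10_retilt` (`EmeryBoxesHg1223OPThermalCapRetiltBoxp1`; `6 log 2 + 46.3593·β`; flat word 54.3593).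
ATOMIC DATA: Cu at `μ_d = −(εp + Δ_hi) = 8`, `U_d,hi = 899/100`; O at `μ_p = −εp = 101/10`, `U_p,hi = 531/100` ⇒ classical slope 37.7800·β (family slope 38.3639; cap 46.3593).
RESULT: **`emeryBoxHg1223OP_pressureWindowHighT_m101o10`**: `max(atomic, family) ≤ P_cell ≤ 6 log 2 + 46.3593·β` on the whole box, every β ≥ 0; width → 0 as β → 0 (both sides `6 log 2`,
`emeryBoxHg1223OP_pressure_beta_zero_m101o10`); crossover β* ≈ 1.366 (T* ≈ 8497 K) below which the atomic floor is the better floor [float].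

Everything PROVED (0 sorry); no definition. HONEST FRAMING: CERTIFIED inequalities on a SCREENING/EXTRAPOLATED-grade object; the atomic floor ignores hopping (its slope sits
0.5839 below the family floor's), so at physical temperatures (β ≈ 20–40 eV⁻¹) the family floor still decides and thermal scales are NOT resolved there; what is new
is the correct INFINITE-TEMPERATURE closure of the window and a certified high-T regime (β ≲ β*) with width `≈ 8.5793·β`; grand-canonical at the stated level; no phase word;
no router number moves. WHAT-THIS-IS-NOT: a new certificate (pure algebra on landed objects; zero kit).
-/

noncomputable section

namespace Summit.Ventures.CertifiedManyBodySolver.Downfold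

open NonemptyInterval Matrix Finset Literature.Probability.LatticeModels
open Literature.MathematicalPhysics.QuantumLattice Literature.Computation.Certificates
open Summit.Ventures.CertifiedManyBodySolver.Certificates OccupationCode ClusterLowerBound
open scoped BigOperators ComplexOrder

/-! ## §1 The atomic-limit floor on the box at εp = -101/10 -/

/-- **ATOMIC-LIMIT `T > 0` FLOOR** on the whole `emeryBoxHg1223OP`, cuprate signs, level εp = -101/10 (chemical potential 101/10 eV), EVERY β ≥ 0:
`log z₀(β; U_d = 899/100, μ_d = 8) + 2·log z₀(β; U_p = 531/100, μ_p = 101/10) ≤ P_cell` with `z₀(β; U, μ) = 1 + 2e^{βμ} + e^{−β(U−2μ)}` (`atomicPartitionFnReal`; Cu at the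
box's upper level `εp + Δ_hi = -8` and `U_d,hi`, O at `εp` and `U_p,hi`). Value `6 log 2` at β = 0; slope `37.7800·β` as β → ∞ (classical minimum, no hopping).
[cite: Ruelle1969, §2.5–2.6] [cite: Ueltschi1999, §3] -/
theorem emeryBoxHg1223OP_pressureAtomicFloor_m101o10 {β : ℝ} (hβ : 0 ≤ β) :
    HoldsOn (fun p : EmeryCoord → ℝ => Real.log (atomicPartitionFnReal β (899/100 : ℝ) (8 : ℝ)) + 2 * Real.log (atomicPartitionFnReal β (531/100 : ℝ) (101/10 : ℝ)) ≤ emeryCellPressure β (emeryLine cuprateSigns (emeryLineCoords (((-101/10 : ℚ)) : ℝ) p))) emeryBoxHg1223OP := by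
  intro p hp
  have h := holdsOn_emeryCellPressureAtomicFloor (E := emeryBoxHg1223OP) (eA := hg1223OPEmery_tpd) (eB := hg1223OPEmery_tpp) (eD := hg1223OPEmery_Delta) (eUd := hg1223Emery_Udd) (eUp := hg1223Emery_Upp) (-101/10) rfl rfl rfl rfl rfl cuprateSigns hβ p hp
  simp only [hg1223OPEmery_Delta, hg1223Emery_Udd, hg1223Emery_Upp, Entry.encl_ofEnds_snd] at h
  push_cast at h
  norm_num at h ⊢
  exact h

/-! ## §2 The best floor and the HIGH-TEMPERATURE-CLOSING window -/

/-- **BEST `T > 0` FLOOR = max(atomic, family)** on the whole box at εp = -101/10, every β ≥ 0: the atomic floor (full entropy, slope 37.7800) wins for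
β < β* ≈ 1.366 (T > 8497 K), the family floor `emeryBoxHg1223OP_pressureFloorFam_m101o10` (slope 38.3639, entropy ¼·log 2) for β > β*. [cite: Ruelle1969, §2.5–2.6] [cite: Israel1979, Lemma II.3.1] -/
theorem emeryBoxHg1223OP_pressureFloorBest_m101o10 {β : ℝ} (hβ : 0 ≤ β) :
    HoldsOn (fun p : EmeryCoord → ℝ => max (Real.log (atomicPartitionFnReal β (899/100 : ℝ) (8 : ℝ)) + 2 * Real.log (atomicPartitionFnReal β (531/100 : ℝ) (101/10 : ℝ))) (Real.log (Real.exp (-(β * (-151749501/1000000 : ℝ))) + Real.exp (-(β * (-153455441/1000000 : ℝ)))) / 4) ≤ emeryCellPressure β (emeryLine cuprateSigns (emeryLineCoords (((-101/10 : ℚ)) : ℝ) p))) emeryBoxHg1223OP :=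
  fun p hp => max_le (emeryBoxHg1223OP_pressureAtomicFloor_m101o10 hβ p hp) (emeryBoxHg1223OP_pressureFloorFam_m101o10 hβ p hp)

/-- **THE HIGH-TEMPERATURE-CLOSING TWO-SIDED `T > 0` WINDOW** (hypothesis-free on both sides) on the whole `emeryBoxHg1223OP`, level εp = -101/10, EVERY β ≥ 0:
`max(atomic, family) ≤ P_cell ≤ 6 log 2 + β·927186407/20000000` (cap = `emeryBoxHg1223OP_pressureCap_m101o10_retilt`, hubbard-box-p1 re-tilted). BOTH SIDES EQUAL `6 log 2` AT β = 0; the width is `O(β)` for small β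
(slope gap 8.5793 against the atomic floor, 7.9955 against the family floor). Table [float; `T = 11604.5/β` K]:
| β (1/eV) | T (K) | atomic floor | family floor | best floor | cap | width |
|---|---|---|---|---|---|---|
| 0.01 | 1160450 | 4.3953 | 0.5548 | 4.3953 | 4.6225 | 0.2272 |
| 0.1 | 116045 | 6.7924 | 3.9893 | 6.7924 | 8.7948 | 2.0024 |
| 0.5 | 23209 | 20.1922 | 19.2707 | 20.1922 | 27.3385 | 7.1464 |
| 1 | 11604 | 38.6767 | 38.4056 | 38.6767 | 50.5182 | 11.8415 |
| 2 | 5802 | 76.3202 | 76.7358 | 76.7358 | 96.8775 | 20.1417 |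
| 5 | 2321 | 189.5967 | 191.8194 | 191.8194 | 235.9555 | 44.1361 |
| 10 | 1160 | 378.4932 | 383.6386 | 383.6386 | 467.7521 | 84.1135 |
| 20 | 580 | 756.2931 | 767.2772 | 767.2772 | 931.3453 | 164.0681 |
| 40 | 290 | 1511.8931 | 1534.5544 | 1534.5544 | 1858.5317 | 323.9773 |
[cite: Israel1979, Thm. I.2.4] [cite: Ruelle1969, §2.5–2.6] [cite: Ueltschi1999, §3] -/
theorem emeryBoxHg1223OP_pressureWindowHighT_m101o10 {β : ℝ} (hβ : 0 ≤ β) :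
    HoldsOn (fun p : EmeryCoord → ℝ =>
      max (Real.log (atomicPartitionFnReal β (899/100 : ℝ) (8 : ℝ)) + 2 * Real.log (atomicPartitionFnReal β (531/100 : ℝ) (101/10 : ℝ))) (Real.log (Real.exp (-(β * (-151749501/1000000 : ℝ))) + Real.exp (-(β * (-153455441/1000000 : ℝ)))) / 4) ≤ emeryCellPressure β (emeryLine cuprateSigns (emeryLineCoords (((-101/10 : ℚ)) : ℝ) p)) ∧
      emeryCellPressure β (emeryLine cuprateSigns (emeryLineCoords (((-101/10 : ℚ)) : ℝ) p)) ≤ 6 * Real.log 2 + β * (927186407/20000000 : ℝ)) emeryBoxHg1223OP :=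
  fun p hp => ⟨emeryBoxHg1223OP_pressureFloorBest_m101o10 hβ p hp, by simpa using emeryBoxHg1223OP_pressureCap_m101o10_retilt hβ p hp⟩

/-- **At β = 0 the window is a point**: `P_cell(0, ·) = 6 log 2` on the whole box (floor and cap coincide). [cite: Ueltschi1999, §3] -/
theorem emeryBoxHg1223OP_pressure_beta_zero_m101o10 :
    HoldsOn (fun p : EmeryCoord → ℝ => emeryCellPressure 0 (emeryLine cuprateSigns (emeryLineCoords (((-101/10 : ℚ)) : ℝ) p)) = 6 * Real.log 2) emeryBoxHg1223OP := by
  intro p hp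
  have h := emeryBoxHg1223OP_pressureWindowHighT_m101o10 le_rfl p hp
  rw [atomicPartitionFnReal_beta_zero, atomicPartitionFnReal_beta_zero, show (4 : ℝ) = 2 ^ 2 by norm_num, Real.log_pow] at h
  push_cast at h
  have h1 := (le_max_left _ _).trans h.1
  linarith [h.2]

end Summit.Ventures.CertifiedManyBodySolver.Downfold

end
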